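import Mathlib.Analysis.SpecialFunctions.Integrals.Basic
import Mathlib.Analysis.SpecialFunctions.Log.Deriv
import Mathlib.Analysis.SpecialFunctions.Pow.Real
import Mathlib.MeasureTheory.Integral.IntervalIntegral.FundThmCalculus
import Mathlib.MeasureTheory.Integral.IntervalIntegral.IntegrationByParts
import Mathlib.MeasureTheory.Integral.IntegralEqImproper
import Mathlib.MeasureTheory.Function.Floor
import Mathlib.Analysis.Complex.ExponentialBounds
import HarnessLib

/-!
# RH-FREE real analysis (Cesàro means of Dirichlet-type step functions through a Riesz mean) — «nothing here bears on the truth of RH»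
# The Cesàro-mean engine behind Hayani 2025, Thm 1.4 (mean value of `π_{1/2}(x;q,a) − π_{1/2}(x;q,b)`)

LINE 1 — LABEL: RH-FREE. Pure real/complex analysis, no zeta or `L`-function input; written for the discharge of the
GRH-CONDITIONAL named fact `Literature.NumberTheory.LFunctions.Hayani2025_thm1_4`
(`ChebyshevBiasNaturalDensity.lean`; M. Hayani, *Chebyshev's bias without linear independence*, arXiv:2512.23302,
Thm 1.4 — a 2025 descendant of Suzuki, Ramanujan J. 68 (2025) = arXiv:2411.07436, RH literature-typing tranche 1
part 2). Nothing in this file is, or is worded as, progress toward RH or GRH.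

## What is here (all PROVED; definitions are glue)

For a coefficient sequence `a : ℕ → ℂ` with `a(1) = 0` put `f_a(v) = Σ_{n ≤ v} a(n) log(v/n)` (`rieszSum`; for
`a(n) = Λ(n)χ(n)n^{-1/2}` this is the tree's `HalfLineRiesz.halfLineSum χ`, Suzuki's `f_χ` of (4.3)) and consider the
Cesàro numerator `Σ_{n ≤ x} (a(n)/log n)(x − n) = ∫₁^x Σ_{n ≤ u} a(n)/log n du` (`cesaroNum`, `integral_stepSum`).

* `cesaroNum_div_eq` — the EXACT identity
  `(1/x) Σ_{n ≤ x} (a(n)/log n)(x − n) = f_a(x)/log x + ∫₂^x f_a(v) φ_x(v) dv`,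
  `φ_x(v) = 2/(v log³v) − (1/x)(1/log v − 2/log²v + 2/log³v)` (`kernel`), from the per-`w` identity
  `log(x/w)/log x + ∫_w^x log(v/w) φ_x(v) dv = (x − w)/(x log w)` (`integral_perW`, an explicit antiderivative).
* `gtwo_identity` — `g₂(x)/log x + ∫₂^x g₂ φ_x = log log x − log log 2 − (1/x)∫₂^x dv/log v` for
  `g₂(v) = log²(v/2)/2`; with `integral_perW` at `w = 2` these evaluate the main terms.
* `cesaro_of_rieszBound` — **if `‖f_a(v) + c₀ log v + (m/2) log²v‖ ≤ B` for `v > 1`, then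
  `‖(1/x) Σ_{n ≤ x} (a(n)/log n)(x − n) + m log log x − C‖ ≤ K/log x` for all `x ≥ 2`** (some `C`, `K`): the
  bounded error contributes `O(1/log x)` through `e(x)/log x`, `∫_x^∞ e φ₁ ≤ B/log²x`, `(1/x)∫₂^x |Φ₂| ≤ 45/log x`
  (`integral_inv_log_le`: `∫₂^x dv/log v ≤ 5x/log x`).
* `cesaro_of_pointwise` — if a step function `S_c(u) = Σ_{n ≤ u} c(n)` satisfies
  `‖S_c(u) − α log log u − β‖ ≤ K/log u` (`u ≥ u₀ ≥ 2`), then `‖(1/x)Σ_{n ≤ x} c(n)(x − n) − α log log x − β‖ ≤ K'/log x`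
  (`∫ log log u du` by parts, `integral_loglog`).

DESIGN (deviation from the printed proof, recorded): Hayani proves Thm 1.4 through `π(x; t)`, the truncated explicit
formula for `ψ(x, χ)` and `|∫Δ| ≪ log Y` (Lemma 2.3 (1)). The tree already holds the SMOOTHED half-line explicit
formula with BOUNDED error under GRH (`HalfLineRiesz.exists_norm_halfLineSum_add_le_of_GRH{,_of_zero}`,
`HalfLineRieszImprimitive.exists_norm_halfLineSum_add_le_of_GRH'`, Suzuki (4.5)/(4.5')); the identity
`cesaroNum_div_eq` feeds that bound directly into the Cesàro mean (shorter road, same theorem; the error comes out as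
`O(1/log x) ⊂ O(log log x/log x)`).

## References
* [Hayani2025] M. Hayani, *Chebyshev's bias without linear independence*, arXiv:2512.23302 (2025), Thm 1.4, §3.
* [Suzuki2025Chebyshev] M. Suzuki, Ramanujan J. 68 (2025) 95 = arXiv:2411.07436, §4.1 (4.3)–(4.5).
* [MontgomeryVaughan2007] H. L. Montgomery, R. C. Vaughan, *Multiplicative Number Theory I*, CUP 2007, §2.1
  (partial summation; Riesz typical means §5.1) — the `[folklore]` calculus below.
-/

noncomputable section

open Real MeasureTheory Set Filter intervalIntegral
open scoped Topology Interval

namespace Literature.NumberTheory.LFunctions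

namespace Hayani2025Mean

/-! ## §1 The kernel `φ_x(v) = 2/(v log³v) − (1/x)(1/log v − 2/log²v + 2/log³v)` and two exact integrals -/

/-- `φ₁(v) = 2/(v log³ v)`. [folklore] -/
def phi1 (v : ℝ) : ℝ := 2 / (v * Real.log v ^ 3)

/-- `Φ₂(v) = 1/log v − 2/log² v + 2/log³ v` (the derivative of `v/log v − v/log² v`). [folklore] -/
def Phi2 (v : ℝ) : ℝ := 1 / Real.log v - 2 / Real.log v ^ 2 + 2 / Real.log v ^ 3

/-- The Cesàro kernel `φ_x(v) = φ₁(v) − Φ₂(v)/x`. [folklore] -/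
def kernel (x v : ℝ) : ℝ := phi1 v - Phi2 v / x

/-- The antiderivative in `v` of `log(v/w) φ_x(v)`:
`A(v) = −2/log v + log w/log² v − (1/x)((log v − log w)(v/log v − v/log² v) − v/log v)`. [folklore] -/
private def perWAnti (w x v : ℝ) : ℝ :=
  -2 / Real.log v + Real.log w / Real.log v ^ 2 -
    (1 / x) * ((Real.log v - Real.log w) * (v / Real.log v - v / Real.log v ^ 2) - v / Real.log v)

/-- `d/dv A(v) = (log v − log w) φ_x(v)` for `v > 1`. [folklore] -/
private theorem hasDerivAt_perWAnti (w x : ℝ) (hx : x ≠ 0) {v : ℝ} (hv : 1 < v) :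
    HasDerivAt (perWAnti w x) ((Real.log v - Real.log w) * kernel x v) v := by
  have hv0 : 0 < v := by linarith
  have hL : 0 < Real.log v := Real.log_pos hv
  have hLne : Real.log v ≠ 0 := hL.ne'
  have h1 : HasDerivAt Real.log v⁻¹ v := Real.hasDerivAt_log hv0.ne'
  have h2 : HasDerivAt (fun y ↦ Real.log y * Real.log y) (v⁻¹ * Real.log v + Real.log v * v⁻¹) v := h1.mul h1
  have hL2ne : Real.log v * Real.log v ≠ 0 := mul_ne_zero hLne hLne
  -- pieces
  have hA : HasDerivAt (fun y ↦ (Real.log y)⁻¹) (-(v⁻¹) / (Real.log v) ^ 2) v := h1.inv hLne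
  have hB : HasDerivAt (fun y ↦ (Real.log y * Real.log y)⁻¹)
      (-(v⁻¹ * Real.log v + Real.log v * v⁻¹) / (Real.log v * Real.log v) ^ 2) v := h2.inv hL2ne
  have hC : HasDerivAt (fun y ↦ y / Real.log y) ((1 * Real.log v - v * v⁻¹) / (Real.log v) ^ 2) v :=
    (hasDerivAt_id v).div h1 hLne
  have hD : HasDerivAt (fun y ↦ y / (Real.log y * Real.log y))
      ((1 * (Real.log v * Real.log v) - v * (v⁻¹ * Real.log v + Real.log v * v⁻¹)) /
        (Real.log v * Real.log v) ^ 2) v := (hasDerivAt_id v).div h2 hL2ne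
  have hE : HasDerivAt (fun y ↦ Real.log y - Real.log w) (v⁻¹ - 0) v := h1.sub (hasDerivAt_const v _)
  have hF := ((hE.mul (hC.sub hD)).sub hC).const_mul (1 / x)
  have hG := ((hA.const_mul (-2)).add (hB.const_mul (Real.log w))).sub hF
  have hfun : perWAnti w x = fun y ↦ -2 * (Real.log y)⁻¹ + Real.log w * (Real.log y * Real.log y)⁻¹ -
      1 / x * ((Real.log y - Real.log w) * (y / Real.log y - y / (Real.log y * Real.log y)) - y / Real.log y) := by
    funext y
    simp only [perWAnti, pow_two]
    ring
  rw [hfun]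
  refine hG.congr_deriv ?_
  simp only [kernel, phi1, Phi2, Pi.sub_apply]
  field_simp
  ring

/-- `log` is continuous on a set of reals `> 1`. [folklore] -/
private theorem continuousOn_log_of_one_lt {s : Set ℝ} (hs : ∀ v ∈ s, 1 < v) : ContinuousOn Real.log s :=
  Real.continuousOn_log.mono fun v hv ↦ ne_of_gt (lt_trans zero_lt_one (hs v hv))

/-- `φ₁` is continuous on a set of reals `> 1`. [folklore] -/
private theorem continuousOn_phi1 {s : Set ℝ} (hs : ∀ v ∈ s, 1 < v) : ContinuousOn phi1 s := by
  have h : phi1 = fun v ↦ 2 / (v * Real.log v ^ 3) := rfl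
  rw [h]
  exact continuousOn_const.div (continuousOn_id.mul ((continuousOn_log_of_one_lt hs).pow 3)) fun v hv ↦
    mul_ne_zero (ne_of_gt (lt_trans zero_lt_one (hs v hv))) (pow_ne_zero _ (Real.log_pos (hs v hv)).ne')

/-- `Φ₂` is continuous on a set of reals `> 1`. [folklore] -/
private theorem continuousOn_Phi2 {s : Set ℝ} (hs : ∀ v ∈ s, 1 < v) : ContinuousOn Phi2 s := by
  have h : Phi2 = fun v ↦ 1 / Real.log v - 2 / Real.log v ^ 2 + 2 / Real.log v ^ 3 := rfl
  rw [h]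
  have hlog := continuousOn_log_of_one_lt hs
  have hne : ∀ v ∈ s, Real.log v ≠ 0 := fun v hv ↦ (Real.log_pos (hs v hv)).ne'
  exact ((continuousOn_const.div hlog hne).sub
    (continuousOn_const.div (hlog.pow 2) fun v hv ↦ pow_ne_zero _ (hne v hv))).add
    (continuousOn_const.div (hlog.pow 3) fun v hv ↦ pow_ne_zero _ (hne v hv))

/-- The kernel `φ_x` is continuous on a set of reals `> 1`. [folklore] -/
private theorem continuousOn_kernel (x : ℝ) {s : Set ℝ} (hs : ∀ v ∈ s, 1 < v) : ContinuousOn (fun v ↦ kernel x v) s := by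
  have h : (fun v ↦ kernel x v) = fun v ↦ phi1 v - Phi2 v / x := rfl
  rw [h]
  exact (continuousOn_phi1 hs).sub ((continuousOn_Phi2 hs).div_const _)

/-- **The per-`w` identity**: for `1 < w ≤ x`,
`∫_w^x (log v − log w) φ_x(v) dv = (x − w)/(x log w) − (log x − log w)/log x`. [folklore] -/
private theorem integral_perW {w x : ℝ} (hw : 1 < w) (hwx : w ≤ x) :
    ∫ v in w..x, (Real.log v - Real.log w) * kernel x v =
      (x - w) / (x * Real.log w) - (Real.log x - Real.log w) / Real.log x := by
  have hx1 : 1 < x := lt_of_lt_of_le hw hwx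
  have hx0 : x ≠ 0 := by positivity
  have hwL : 0 < Real.log w := Real.log_pos hw
  have hxL : 0 < Real.log x := Real.log_pos hx1
  have hderiv : ∀ v ∈ uIcc w x, HasDerivAt (perWAnti w x) ((Real.log v - Real.log w) * kernel x v) v := by
    intro v hv
    rw [uIcc_of_le hwx] at hv
    exact hasDerivAt_perWAnti w x hx0 (lt_of_lt_of_le hw hv.1)
  have hcont : ContinuousOn (fun v ↦ (Real.log v - Real.log w) * kernel x v) (uIcc w x) := by
    rw [uIcc_of_le hwx]
    have hs : ∀ v ∈ Icc w x, 1 < v := fun v hv ↦ lt_of_lt_of_le hw hv.1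
    exact ((continuousOn_log_of_one_lt hs).sub continuousOn_const).mul (continuousOn_kernel x hs)
  rw [integral_eq_sub_of_hasDerivAt hderiv (hcont.intervalIntegrable)]
  simp only [perWAnti, sub_self, zero_mul, zero_sub]
  field_simp
  ring

/-- `g₂(v) = (log v − log 2)²/2`, the quadratic main-term profile. [folklore] -/
def gtwo (v : ℝ) : ℝ := (Real.log v - Real.log 2) ^ 2 / 2

/-- The elementary part of the antiderivative of `g₂ φ_x`:
`E₃(v) = log log v + 2 log 2/log v − log²2/(2 log²v) − (1/x)(g₂(v)(v/log v − v/log²v) − v + log 2 · v/log v)`. [folklore] -/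
private def gtwoAnti (x v : ℝ) : ℝ :=
  Real.log (Real.log v) + 2 * Real.log 2 / Real.log v - Real.log 2 ^ 2 / (2 * Real.log v ^ 2) -
    (1 / x) * (gtwo v * (v / Real.log v - v / Real.log v ^ 2) - v + Real.log 2 * (v / Real.log v))

/-- `d/dv E₃(v) = g₂(v) φ_x(v) + 1/(x log v)` for `v > 1`. [folklore] -/
private theorem hasDerivAt_gtwoAnti (x : ℝ) (hx : x ≠ 0) {v : ℝ} (hv : 1 < v) :
    HasDerivAt (gtwoAnti x) (gtwo v * kernel x v + 1 / (x * Real.log v)) v := by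
  have hv0 : 0 < v := by linarith
  have hL : 0 < Real.log v := Real.log_pos hv
  have hLne : Real.log v ≠ 0 := hL.ne'
  have h1 : HasDerivAt Real.log v⁻¹ v := Real.hasDerivAt_log hv0.ne'
  have h2 : HasDerivAt (fun y ↦ Real.log y * Real.log y) (v⁻¹ * Real.log v + Real.log v * v⁻¹) v := h1.mul h1
  have hL2ne : Real.log v * Real.log v ≠ 0 := mul_ne_zero hLne hLne
  have hLL : HasDerivAt (fun y ↦ Real.log (Real.log y)) ((Real.log v)⁻¹ * v⁻¹) v :=
    (Real.hasDerivAt_log hLne).comp v h1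
  have hA : HasDerivAt (fun y ↦ (Real.log y)⁻¹) (-(v⁻¹) / (Real.log v) ^ 2) v := h1.inv hLne
  have hB : HasDerivAt (fun y ↦ (Real.log y * Real.log y)⁻¹)
      (-(v⁻¹ * Real.log v + Real.log v * v⁻¹) / (Real.log v * Real.log v) ^ 2) v := h2.inv hL2ne
  have hC : HasDerivAt (fun y ↦ y / Real.log y) ((1 * Real.log v - v * v⁻¹) / (Real.log v) ^ 2) v :=
    (hasDerivAt_id v).div h1 hLne
  have hD : HasDerivAt (fun y ↦ y / (Real.log y * Real.log y))
      ((1 * (Real.log v * Real.log v) - v * (v⁻¹ * Real.log v + Real.log v * v⁻¹)) /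
        (Real.log v * Real.log v) ^ 2) v := (hasDerivAt_id v).div h2 hL2ne
  have hE : HasDerivAt (fun y ↦ (Real.log y - Real.log 2) * (Real.log y - Real.log 2) / 2)
      (((v⁻¹ - 0) * (Real.log v - Real.log 2) + (Real.log v - Real.log 2) * (v⁻¹ - 0)) / 2) v :=
    ((h1.sub (hasDerivAt_const v _)).mul (h1.sub (hasDerivAt_const v _))).div_const 2
  have hS := (((hE.mul (hC.sub hD)).sub (hasDerivAt_id v)).add (hC.const_mul (Real.log 2))).const_mul (1 / x)
  have hG := ((hLL.add (hA.const_mul (2 * Real.log 2))).sub (hB.const_mul (Real.log 2 ^ 2 / 2))).sub hS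
  have hfun : gtwoAnti x = fun y ↦ Real.log (Real.log y) + 2 * Real.log 2 * (Real.log y)⁻¹ -
      Real.log 2 ^ 2 / 2 * (Real.log y * Real.log y)⁻¹ -
      1 / x * ((Real.log y - Real.log 2) * (Real.log y - Real.log 2) / 2 *
        (y / Real.log y - y / (Real.log y * Real.log y)) - id y + Real.log 2 * (y / Real.log y)) := by
    funext y
    simp only [gtwoAnti, gtwo, pow_two, id]
    field_simp
  rw [hfun]
  refine hG.congr_deriv ?_
  simp only [kernel, phi1, Phi2, gtwo, Pi.sub_apply]
  field_simp
  ring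

/-- `g₂` is continuous on a set of reals `> 1`. [folklore] -/
private theorem continuousOn_gtwo {s : Set ℝ} (hs : ∀ v ∈ s, 1 < v) : ContinuousOn gtwo s := by
  have h : gtwo = fun v ↦ (Real.log v - Real.log 2) ^ 2 / 2 := rfl
  rw [h]
  exact (((continuousOn_log_of_one_lt hs).sub continuousOn_const).pow 2).div_const _

/-- **The `g₂` identity**: for `x ≥ 2`,
`g₂(x)/log x + ∫₂^x g₂(v) φ_x(v) dv = log log x − log log 2 − (1/x)∫₂^x dv/log v`. [folklore] -/
private theorem gtwo_identity {x : ℝ} (hx : 2 ≤ x) :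
    gtwo x / Real.log x + ∫ v in (2 : ℝ)..x, gtwo v * kernel x v =
      Real.log (Real.log x) - Real.log (Real.log 2) - (1 / x) * ∫ v in (2 : ℝ)..x, 1 / Real.log v := by
  have hx1 : 1 < x := by linarith
  have hx0 : x ≠ 0 := by positivity
  have hxL : 0 < Real.log x := Real.log_pos hx1
  have h2L : 0 < Real.log 2 := Real.log_pos (by norm_num)
  have hs : ∀ v ∈ uIcc 2 x, 1 < v := fun v hv ↦ by
    rw [uIcc_of_le hx] at hv; linarith [hv.1]
  have hderiv : ∀ v ∈ uIcc 2 x, HasDerivAt (gtwoAnti x) (gtwo v * kernel x v + 1 / (x * Real.log v)) v :=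
    fun v hv ↦ hasDerivAt_gtwoAnti x hx0 (hs v hv)
  have hc1 : ContinuousOn (fun v ↦ gtwo v * kernel x v) (uIcc 2 x) :=
    (continuousOn_gtwo hs).mul (continuousOn_kernel x hs)
  have hc2 : ContinuousOn (fun v ↦ 1 / (x * Real.log v)) (uIcc 2 x) :=
    continuousOn_const.div (continuousOn_const.mul (continuousOn_log_of_one_lt hs)) fun v hv ↦
      mul_ne_zero hx0 (Real.log_pos (hs v hv)).ne'
  have hint := integral_eq_sub_of_hasDerivAt hderiv ((hc1.add hc2).intervalIntegrable)
  rw [intervalIntegral.integral_add hc1.intervalIntegrable hc2.intervalIntegrable] at hint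
  have h3 : ∫ v in (2 : ℝ)..x, 1 / (x * Real.log v) = (1 / x) * ∫ v in (2 : ℝ)..x, 1 / Real.log v := by
    rw [← intervalIntegral.integral_const_mul]
    refine intervalIntegral.integral_congr fun v _ ↦ ?_
    ring
  rw [h3] at hint
  have h4 : ∫ v in (2 : ℝ)..x, gtwo v * kernel x v =
      gtwoAnti x x - gtwoAnti x 2 - (1 / x) * ∫ v in (2 : ℝ)..x, 1 / Real.log v := by
    linarith
  rw [h4]
  simp only [gtwoAnti, gtwo, sub_self]
  field_simp
  ring

/-! ## §2 Elementary bounds: `∫₂^x dv/log v ≤ 5x/log x`, `1/x ≤ 1/log x`, `∫_x^∞ φ₁ = 1/log²x` -/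

/-- `log x ≤ 2√x` for `x ≥ 0` hmm `x > 0`. [folklore] -/
private theorem log_le_two_mul_sqrt {x : ℝ} (hx : 0 < x) : Real.log x ≤ 2 * Real.sqrt x := by
  have hs : 0 < Real.sqrt x := Real.sqrt_pos.2 hx
  have h1 : Real.log (Real.sqrt x) ≤ Real.sqrt x - 1 := Real.log_le_sub_one_of_pos hs
  have h2 : Real.log (Real.sqrt x) = Real.log x / 2 := Real.log_sqrt hx.le
  linarith

/-- `1/x ≤ 1/log x` for `x > 1`. [folklore] -/
private theorem inv_le_inv_log {x : ℝ} (hx : 1 < x) : 1 / x ≤ 1 / Real.log x := by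
  have hL : 0 < Real.log x := Real.log_pos hx
  have h : Real.log x ≤ x := (Real.log_le_sub_one_of_pos (by linarith)).trans (by linarith)
  exact one_div_le_one_div_of_le hL h

/-- **`∫₂^x dv/log v ≤ 5x/log x`** for `x ≥ 2` (split at `√x`). [folklore] -/
private theorem integral_inv_log_le {x : ℝ} (hx : 2 ≤ x) :
    ∫ v in (2 : ℝ)..x, 1 / Real.log v ≤ 5 * x / Real.log x := by
  have hx1 : 1 < x := by linarith
  have hxL : 0 < Real.log x := Real.log_pos hx1
  have h2L : 0 < Real.log 2 := Real.log_pos (by norm_num)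
  have hlog2 : (0.6931471803 : ℝ) < Real.log 2 := Real.log_two_gt_d9
  -- a crude bound on any piece `[a, b] ⊆ [2, ∞)`: `∫_a^b dv/log v ≤ (b − a)/log a`
  have piece : ∀ a b : ℝ, 2 ≤ a → a ≤ b → ∫ v in a..b, 1 / Real.log v ≤ (b - a) / Real.log a := by
    intro a b ha hab
    have haL : 0 < Real.log a := Real.log_pos (by linarith)
    have hbd : ∀ v ∈ Ι a b, ‖1 / Real.log v‖ ≤ 1 / Real.log a := by
      intro v hv
      rw [uIoc_of_le hab] at hv
      have hvL : Real.log a ≤ Real.log v := Real.log_le_log (by linarith) hv.1.le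
      have hvL0 : 0 < Real.log v := lt_of_lt_of_le haL hvL
      rw [Real.norm_of_nonneg (by positivity)]
      exact one_div_le_one_div_of_le haL hvL
    have h := intervalIntegral.norm_integral_le_of_norm_le_const hbd
    rw [abs_of_nonneg (by linarith)] at h
    calc ∫ v in a..b, 1 / Real.log v ≤ ‖∫ v in a..b, 1 / Real.log v‖ := Real.le_norm_self _
      _ ≤ 1 / Real.log a * (b - a) := h
      _ = (b - a) / Real.log a := by ring
  by_cases h4 : x ≤ 4
  · -- `∫₂^x ≤ (x−2)/log 2 ≤ 2/log 2 ≤ 5x/log x` since `log x ≤ log 4 = 2 log 2`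
    have h := piece 2 x le_rfl hx
    have hlog4 : Real.log x ≤ 2 * Real.log 2 := by
      rw [show (2 : ℝ) * Real.log 2 = Real.log 4 by
        rw [show (4 : ℝ) = 2 ^ 2 by norm_num, Real.log_pow]; norm_num]
      exact Real.log_le_log (by linarith) h4
    calc ∫ v in (2 : ℝ)..x, 1 / Real.log v ≤ (x - 2) / Real.log 2 := h
      _ ≤ 2 / Real.log 2 := by gcongr; linarith
      _ ≤ 5 * x / Real.log x := by
          rw [div_le_div_iff₀ h2L hxL]
          nlinarith
  · push Not at h4
    have hs2 : 2 ≤ Real.sqrt x := by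
      have h24 : Real.sqrt 4 = 2 := by
        rw [show (4 : ℝ) = 2 ^ 2 by norm_num, Real.sqrt_sq (by norm_num)]
      rw [← h24]
      exact Real.sqrt_le_sqrt h4.le
    have hsx : Real.sqrt x ≤ x := by
      have := Real.sqrt_le_sqrt (show x ≤ x ^ 2 by nlinarith)
      rwa [Real.sqrt_sq (by linarith)] at this
    have hs0 : 0 < Real.sqrt x := by linarith
    have hsL : Real.log (Real.sqrt x) = Real.log x / 2 := Real.log_sqrt (by linarith)
    have hc1 : ContinuousOn (fun v ↦ 1 / Real.log v) (uIcc 2 x) := by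
      have hs : ∀ v ∈ uIcc 2 x, 1 < v := fun v hv ↦ by rw [uIcc_of_le hx] at hv; linarith [hv.1]
      exact continuousOn_const.div (continuousOn_log_of_one_lt hs) fun v hv ↦ (Real.log_pos (hs v hv)).ne'
    have hi1 : IntervalIntegrable (fun v ↦ 1 / Real.log v) volume 2 (Real.sqrt x) :=
      (hc1.mono (uIcc_subset_uIcc_left (by rw [uIcc_of_le hx]; exact ⟨hs2, hsx⟩))).intervalIntegrable
    have hi2 : IntervalIntegrable (fun v ↦ 1 / Real.log v) volume (Real.sqrt x) x :=
      (hc1.mono (uIcc_subset_uIcc_right (by rw [uIcc_of_le hx]; exact ⟨hs2, hsx⟩))).intervalIntegrable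
    rw [← intervalIntegral.integral_add_adjacent_intervals hi1 hi2]
    have hp1 := piece 2 (Real.sqrt x) le_rfl hs2
    have hp2 := piece (Real.sqrt x) x hs2 hsx
    rw [hsL] at hp2
    have hlog_sqrt : Real.log x ≤ 2 * Real.sqrt x := log_le_two_mul_sqrt (by linarith)
    -- `(√x − 2)/log 2 ≤ √x/log 2 ≤ 1.45 √x` and `√x log x ≤ 2x`
    have hsq : Real.sqrt x * Real.sqrt x = x := Real.mul_self_sqrt (by linarith)
    have hA : (Real.sqrt x - 2) / Real.log 2 ≤ 3 * x / Real.log x := by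
      rw [div_le_div_iff₀ h2L hxL]
      nlinarith
    have hB : (x - Real.sqrt x) / (Real.log x / 2) ≤ 2 * x / Real.log x := by
      rw [div_le_div_iff₀ (by positivity) hxL]
      nlinarith
    calc (∫ v in (2:ℝ)..Real.sqrt x, 1 / Real.log v) + ∫ v in Real.sqrt x..x, 1 / Real.log v
        ≤ 3 * x / Real.log x + 2 * x / Real.log x := add_le_add (hp1.trans hA) (hp2.trans hB)
      _ = 5 * x / Real.log x := by ring

/-- `∫_a^b dv/log v ≥ 0` for `2 ≤ a ≤ b`. [folklore] -/
private theorem integral_inv_log_nonneg {a b : ℝ} (ha : 2 ≤ a) (hab : a ≤ b) :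
    0 ≤ ∫ v in a..b, 1 / Real.log v := by
  refine intervalIntegral.integral_nonneg hab fun v hv ↦ ?_
  have : 0 < Real.log v := Real.log_pos (by linarith [hv.1])
  positivity

/-- `∫_a^x dv/log v ≤ 5x/log x` for `2 ≤ a ≤ x`. [folklore] -/
private theorem integral_inv_log_le' {a x : ℝ} (ha : 2 ≤ a) (hax : a ≤ x) :
    ∫ v in a..x, 1 / Real.log v ≤ 5 * x / Real.log x := by
  have hx : 2 ≤ x := ha.trans hax
  have hc1 : ContinuousOn (fun v ↦ 1 / Real.log v) (uIcc 2 x) := by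
    have hs : ∀ v ∈ uIcc 2 x, 1 < v := fun v hv ↦ by rw [uIcc_of_le hx] at hv; linarith [hv.1]
    exact continuousOn_const.div (continuousOn_log_of_one_lt hs) fun v hv ↦ (Real.log_pos (hs v hv)).ne'
  have hi1 : IntervalIntegrable (fun v ↦ 1 / Real.log v) volume 2 a :=
    (hc1.mono (uIcc_subset_uIcc_left (by rw [uIcc_of_le hx]; exact ⟨ha, hax⟩))).intervalIntegrable
  have hi2 : IntervalIntegrable (fun v ↦ 1 / Real.log v) volume a x :=
    (hc1.mono (uIcc_subset_uIcc_right (by rw [uIcc_of_le hx]; exact ⟨ha, hax⟩))).intervalIntegrable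
  have h := intervalIntegral.integral_add_adjacent_intervals hi1 hi2
  have h0 := integral_inv_log_nonneg le_rfl ha
  linarith [integral_inv_log_le hx]

/-- `∫_x^∞ φ₁ = 1/log² x` for `x > 1`, and `φ₁` is integrable there. [folklore] -/
private theorem integral_Ioi_phi1 {x : ℝ} (hx : 1 < x) :
    IntegrableOn phi1 (Ioi x) ∧ ∫ v in Ioi x, phi1 v = 1 / Real.log x ^ 2 := by
  have hderiv : ∀ v ∈ Ici x, HasDerivAt (fun y ↦ -(1 / Real.log y ^ 2)) (phi1 v) v := by
    intro v hv
    have hv1 : 1 < v := lt_of_lt_of_le hx hv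
    have hv0 : 0 < v := by linarith
    have hLne : Real.log v ≠ 0 := (Real.log_pos hv1).ne'
    have h1 : HasDerivAt Real.log v⁻¹ v := Real.hasDerivAt_log hv0.ne'
    have h12 : HasDerivAt (fun y ↦ Real.log y * Real.log y) (v⁻¹ * Real.log v + Real.log v * v⁻¹) v := h1.mul h1
    have h2 := (h12.inv (mul_ne_zero hLne hLne)).neg
    have hfun : (fun y ↦ -(1 / Real.log y ^ 2)) = fun y ↦ -((Real.log y * Real.log y)⁻¹) := by
      funext y; rw [pow_two, one_div]
    rw [hfun]
    refine h2.congr_deriv ?_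
    simp only [phi1]
    field_simp
    ring
  have hpos : ∀ v ∈ Ioi x, 0 ≤ phi1 v := by
    intro v hv
    have hv1 : 1 < v := lt_trans hx hv
    have : 0 < Real.log v := Real.log_pos hv1
    simp only [phi1]
    positivity
  have hlim : Tendsto (fun y : ℝ ↦ -(1 / Real.log y ^ 2)) atTop (𝓝 0) := by
    have h0 : Tendsto (fun y : ℝ ↦ (Real.log y)⁻¹) atTop (𝓝 0) :=
      tendsto_inv_atTop_zero.comp Real.tendsto_log_atTop
    have h := (h0.pow 2).neg
    rw [zero_pow two_ne_zero, neg_zero] at h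
    refine h.congr fun y ↦ ?_
    rw [one_div, inv_pow]
  have hcont : ContinuousWithinAt (fun y ↦ -(1 / Real.log y ^ 2)) (Ici x) x :=
    (hderiv x Set.self_mem_Ici).continuousAt.continuousWithinAt
  have hderiv' : ∀ v ∈ Ioi x, HasDerivAt (fun y ↦ -(1 / Real.log y ^ 2)) (phi1 v) v :=
    fun v hv ↦ hderiv v (Set.mem_Ici.2 (le_of_lt hv))
  refine ⟨integrableOn_Ioi_deriv_of_nonneg hcont hderiv' hpos hlim, ?_⟩
  rw [integral_Ioi_of_hasDerivAt_of_nonneg hcont hderiv' hpos hlim]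
  ring

/-- `|Φ₂(v)| ≤ 9/log v` for `v ≥ 2`. [folklore] -/
private theorem abs_Phi2_le {v : ℝ} (hv : 2 ≤ v) : |Phi2 v| ≤ 9 / Real.log v := by
  have hlog2 : (0.6931471803 : ℝ) < Real.log 2 := Real.log_two_gt_d9
  have hL2 : Real.log 2 ≤ Real.log v := Real.log_le_log (by norm_num) hv
  have hL : 0 < Real.log v := by linarith
  set L := Real.log v with hLdef
  have h1 : |Phi2 v| ≤ 1 / L + 2 / L ^ 2 + 2 / L ^ 3 := by
    simp only [Phi2]
    refine (abs_add_le _ _).trans ?_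
    refine add_le_add ((abs_sub _ _).trans (le_of_eq ?_)) (le_of_eq ?_)
    · rw [abs_of_pos (by positivity), abs_of_pos (by positivity)]
    · rw [abs_of_pos (by positivity)]
  refine h1.trans ?_
  -- `1 + 2/L + 2/L² ≤ 9` since `L ≥ log 2 > 0.69`
  have hL1 : 2 / L ^ 2 ≤ 3 / L := by
    rw [div_le_div_iff₀ (by positivity) hL]
    nlinarith
  have hL3 : 2 / L ^ 3 ≤ 5 / L := by
    rw [div_le_div_iff₀ (by positivity) hL]
    have : L ^ 3 = L * L ^ 2 := by ring
    nlinarith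
  have : 1 / L + 2 / L ^ 2 + 2 / L ^ 3 ≤ 1 / L + 3 / L + 5 / L := by linarith
  refine this.trans (le_of_eq ?_)
  ring

/-! ## §3 Step sums and Riesz sums: measurability, integrability, the integral over `[1, x]` -/

/-- `S_c(u) = Σ_{1 ≤ n ≤ ⌊u⌋} c(n)`. [folklore] -/
def stepSum (c : ℕ → ℂ) (u : ℝ) : ℂ := ∑ n ∈ Finset.Icc 1 ⌊u⌋₊, c n

/-- The Riesz sum `f_a(v) = Σ_{n ≤ v} a(n) log(v/n)` (for `a(n) = Λ(n)χ(n)n^{-1/2}` this is the tree's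
`HalfLineRiesz.halfLineSum χ v`). [folklore] -/
def rieszSum (a : ℕ → ℂ) (v : ℝ) : ℂ := ∑ n ∈ Finset.Icc 1 ⌊v⌋₊, a n * (Real.log (v / n) : ℂ)

/-- The Cesàro numerator `Σ_{n ≤ x} (a(n)/log n)(x − n) = ∫₁^x Σ_{n ≤ u} a(n)/log n du`. [folklore] -/
def cesaroNum (a : ℕ → ℂ) (x : ℝ) : ℂ :=
  ∑ n ∈ Finset.Icc 1 ⌊x⌋₊, a n / (Real.log n : ℂ) * ((x - n : ℝ) : ℂ)

/-- A sum `Σ_{n ≤ ⌊v⌋} g(n, v)` with each `g(n, ·)` measurable is measurable in `v`. [folklore] -/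
private theorem measurable_sum_floor {g : ℕ → ℝ → ℂ} (hg : ∀ n, Measurable (g n)) :
    Measurable fun v : ℝ ↦ ∑ n ∈ Finset.Icc 1 ⌊v⌋₊, g n v := by
  set W : ℕ × ℝ → ℂ := fun p ↦ ∑ n ∈ Finset.Icc 1 p.1, g n p.2 with hW
  have h1 : Measurable W := measurable_from_prod_countable_right fun N ↦ by
    simp only [hW]
    exact Finset.measurable_sum _ fun n _ ↦ hg n
  have h2 : Measurable fun v : ℝ ↦ (⌊v⌋₊, v) := (Nat.measurable_floor (R := ℝ)).prodMk measurable_id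
  exact h1.comp h2

/-- `S_c` is measurable. [folklore] -/
private theorem measurable_stepSum (c : ℕ → ℂ) : Measurable (stepSum c) :=
  measurable_sum_floor (g := fun k _ ↦ c k) fun _ ↦ measurable_const

/-- `f_a` is measurable. [folklore] -/
private theorem measurable_rieszSum (a : ℕ → ℂ) : Measurable (rieszSum a) :=
  measurable_sum_floor (g := fun n v ↦ a n * (Real.log (v / n) : ℂ)) fun _ ↦
    measurable_const.mul (Complex.measurable_ofReal.comp (Real.measurable_log.comp (measurable_id.div_const _)))

/-- `‖S_c(u)‖ ≤ Σ_{n ≤ N} ‖c n‖` whenever `⌊u⌋ ≤ N`. [folklore] -/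
private theorem norm_stepSum_le (c : ℕ → ℂ) {u : ℝ} {N : ℕ} (hN : ⌊u⌋₊ ≤ N) :
    ‖stepSum c u‖ ≤ ∑ n ∈ Finset.Icc 1 N, ‖c n‖ := by
  refine (norm_sum_le _ _).trans ?_
  exact Finset.sum_le_sum_of_subset_of_nonneg (Finset.Icc_subset_Icc_right hN) fun i _ _ ↦ norm_nonneg (c i)

/-- `S_c` is integrable on every bounded interval (so the Riesz mean `∫ S_c` exists). [cite: MontgomeryVaughan2007, §5.1 (5.19)] -/
theorem intervalIntegrable_stepSum (c : ℕ → ℂ) (a b : ℝ) : IntervalIntegrable (stepSum c) volume a b := by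
  rw [intervalIntegrable_iff]
  set N := ⌊max |a| |b|⌋₊ with hN
  refine Measure.integrableOn_of_bounded (M := ∑ n ∈ Finset.Icc 1 N, ‖c n‖) ?_
    (measurable_stepSum c).aestronglyMeasurable ?_
  · rw [Set.uIoc]; exact measure_Ioc_lt_top.ne
  · refine (ae_restrict_mem measurableSet_uIoc).mono fun u hu ↦ norm_stepSum_le c ?_
    have hu' : u ≤ max |a| |b| := by
      rcases Set.mem_uIoc.1 hu with h | h
      · exact h.2.trans ((le_abs_self b).trans (le_max_right _ _))
      · exact h.2.trans ((le_abs_self a).trans (le_max_left _ _))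
    exact Nat.floor_le_floor hu'

/-- **`∫₁^x S_c(u) du = Σ_{n ≤ x} c(n)(x − n)`** for `x ≥ 1` (the Riesz mean of order one as an integral).
[cite: MontgomeryVaughan2007, §5.1 (5.19)] -/
theorem integral_stepSum (c : ℕ → ℂ) {x : ℝ} (hx : 1 ≤ x) :
    ∫ u in (1 : ℝ)..x, stepSum c u = ∑ n ∈ Finset.Icc 1 ⌊x⌋₊, c n * ((x - n : ℝ) : ℂ) := by
  set N := ⌊x⌋₊ with hN
  have hx0 : 0 ≤ x := by linarith
  -- on `[1, x]`, `S_c(u) = Σ_{n ≤ N} 𝟙_{[n, ∞)}(u) c(n)`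
  have hrepr : EqOn (stepSum c) (fun u ↦ ∑ n ∈ Finset.Icc 1 N, (Ici (n : ℝ)).indicator (fun _ ↦ c n) u)
      (uIcc 1 x) := by
    intro u hu
    rw [uIcc_of_le hx] at hu
    have hu0 : 0 ≤ u := by linarith [hu.1]
    simp only [stepSum, Set.indicator_apply, Set.mem_Ici]
    rw [← Finset.sum_filter]
    refine Finset.sum_congr ?_ fun _ _ ↦ rfl
    ext n
    simp only [Finset.mem_Icc, Finset.mem_filter]
    constructor
    · rintro ⟨h1, h2⟩
      exact ⟨⟨h1, h2.trans (Nat.floor_le_floor hu.2)⟩, (Nat.le_floor_iff hu0).1 h2⟩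
    · rintro ⟨⟨h1, -⟩, h2⟩
      exact ⟨h1, (Nat.le_floor_iff hu0).2 h2⟩
  rw [intervalIntegral.integral_congr hrepr]
  have hii : ∀ n ∈ Finset.Icc 1 N,
      IntervalIntegrable (fun u ↦ (Ici (n : ℝ)).indicator (fun _ ↦ c n) u) volume 1 x := by
    intro n _
    rw [intervalIntegrable_iff]
    exact (intervalIntegrable_iff.1 (intervalIntegrable_const (c := c n))).indicator measurableSet_Ici
  rw [intervalIntegral.integral_finsetSum hii]
  refine Finset.sum_congr rfl fun n hn ↦ ?_
  rw [Finset.mem_Icc] at hn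
  have hnx : (n : ℝ) ≤ x := by
    have := Nat.floor_le hx0
    exact le_trans (by exact_mod_cast hn.2) this
  have hn1 : (1 : ℝ) ≤ n := by exact_mod_cast hn.1
  rw [intervalIntegral.integral_of_le hx, setIntegral_indicator measurableSet_Ici, setIntegral_const]
  have hset : Ioc 1 x ∩ Ici (n : ℝ) = Icc (max 1 (n : ℝ)) x \ {1} := by
    ext u
    simp only [mem_inter_iff, mem_Ioc, mem_Ici, Set.mem_sdiff, mem_Icc, max_le_iff, mem_singleton_iff]
    constructor
    · rintro ⟨⟨h1, h2⟩, h3⟩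
      exact ⟨⟨⟨h1.le, h3⟩, h2⟩, ne_of_gt h1⟩
    · rintro ⟨⟨⟨h1, h3⟩, h2⟩, h4⟩
      exact ⟨⟨lt_of_le_of_ne h1 (Ne.symm h4), h2⟩, h3⟩
  have hvol : volume.real (Ioc 1 x ∩ Ici (n : ℝ)) = x - n := by
    rw [hset, measureReal_def, measure_sdiff_null (Real.volume_singleton), Real.volume_Icc,
      max_eq_right hn1, ENNReal.toReal_ofReal (by linarith)]
  rw [hvol, Complex.real_smul, mul_comm]

/-- On `[2, x]` the Riesz sum is a FIXED finite sum of continuous functions: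
`f_a(v) = Σ_{n ≤ ⌊x⌋} a(n) max(log v − log n, 0)`. [folklore] -/
private theorem rieszSum_eq_sum_posPart (a : ℕ → ℂ) {x v : ℝ} (hv : 0 < v) (hvx : v ≤ x) :
    rieszSum a v = ∑ n ∈ Finset.Icc 1 ⌊x⌋₊, a n * ((max (Real.log v - Real.log n) 0 : ℝ) : ℂ) := by
  rw [rieszSum]
  have hsub : Finset.Icc 1 ⌊v⌋₊ ⊆ Finset.Icc 1 ⌊x⌋₊ := Finset.Icc_subset_Icc_right (Nat.floor_le_floor hvx)
  rw [← Finset.sum_subset hsub]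
  · refine Finset.sum_congr rfl fun n hn ↦ ?_
    rw [Finset.mem_Icc] at hn
    have hn0 : (0 : ℝ) < n := by exact_mod_cast hn.1
    have hnv : (n : ℝ) ≤ v := le_trans (by exact_mod_cast hn.2) (Nat.floor_le hv.le)
    rw [Real.log_div hv.ne' hn0.ne', max_eq_left]
    exact sub_nonneg.2 (Real.log_le_log hn0 hnv)
  · intro n hn hn'
    rw [Finset.mem_Icc] at hn hn'
    have hlt : ⌊v⌋₊ < n := by
      by_contra h
      exact hn' ⟨hn.1, not_lt.1 h⟩
    have hvn : v < n := Nat.lt_of_floor_lt hlt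
    have : Real.log v ≤ Real.log n := Real.log_le_log hv hvn.le
    rw [max_eq_right (by linarith)]
    simp

/-- Continuity of `v ↦ max(log v − log n, 0)` on a set of reals `> 1`. [folklore] -/
private theorem continuousOn_posPart_log (n : ℕ) {s : Set ℝ} (hs : ∀ v ∈ s, 1 < v) :
    ContinuousOn (fun v : ℝ ↦ max (Real.log v - Real.log n) 0) s :=
  ContinuousOn.sup ((continuousOn_log_of_one_lt hs).sub continuousOn_const) continuousOn_const

/-- `f_a` is integrable on `[2, x]` (indeed on any `[p, r] ⊆ [2, ∞)`), and so is `f_a · k` for `k` continuous. [folklore] -/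
private theorem intervalIntegrable_rieszSum_mul (a : ℕ → ℂ) {p r : ℝ} (hp : 2 ≤ p) (hpr : p ≤ r) {k : ℝ → ℝ}
    (hk : ContinuousOn k (Icc p r)) :
    IntervalIntegrable (fun v ↦ rieszSum a v * (k v : ℂ)) volume p r := by
  have hs : ∀ v ∈ Icc p r, 1 < v := fun v hv ↦ by linarith [hv.1]
  have hcont : ContinuousOn (fun v ↦ (∑ n ∈ Finset.Icc 1 ⌊r⌋₊,
      a n * ((max (Real.log v - Real.log n) 0 : ℝ) : ℂ)) * (k v : ℂ)) (uIcc p r) := by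
    rw [uIcc_of_le hpr]
    refine (continuousOn_finsetSum _ fun n _ ↦ continuousOn_const.mul ?_).mul
      (Complex.continuous_ofReal.comp_continuousOn hk)
    exact Complex.continuous_ofReal.comp_continuousOn (continuousOn_posPart_log n hs)
  refine hcont.intervalIntegrable.congr_ae ?_
  refine (ae_restrict_mem measurableSet_uIoc).mono fun v hv ↦ ?_
  rw [uIoc_of_le hpr] at hv
  simp only
  rw [rieszSum_eq_sum_posPart a (by linarith [hv.1]) hv.2]

/-! ## §4 The exact Cesàro identity `(1/x)Σ_{n≤x}(a_n/log n)(x−n) = f_a(x)/log x + ∫₂^x f_a φ_x` -/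

/-- For `2 ≤ n ≤ x`: `∫₂^x max(log v − log n, 0) φ_x(v) dv = (x − n)/(x log n) − (log x − log n)/log x`. [folklore] -/
private theorem integral_posPart_kernel {x : ℝ} {n : ℕ} (hn : 2 ≤ n) (hnx : (n : ℝ) ≤ x) :
    ∫ v in (2 : ℝ)..x, max (Real.log v - Real.log n) 0 * kernel x v =
      (x - n) / (x * Real.log n) - (Real.log x - Real.log n) / Real.log x := by
  have hn2 : (2 : ℝ) ≤ n := by exact_mod_cast hn
  have hn1 : (1 : ℝ) < n := by linarith
  have hx2 : 2 ≤ x := hn2.trans hnx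
  have hsI : ∀ v ∈ Icc 2 x, 1 < v := fun v hv ↦ by linarith [hv.1]
  have hc : ContinuousOn (fun v ↦ max (Real.log v - Real.log n) 0 * kernel x v) (uIcc 2 x) := by
    rw [uIcc_of_le hx2]
    exact (continuousOn_posPart_log n hsI).mul (continuousOn_kernel x hsI)
  have hi1 : IntervalIntegrable (fun v ↦ max (Real.log v - Real.log n) 0 * kernel x v) volume 2 n :=
    (hc.mono (uIcc_subset_uIcc_left (by rw [uIcc_of_le hx2]; exact ⟨hn2, hnx⟩))).intervalIntegrable
  have hi2 : IntervalIntegrable (fun v ↦ max (Real.log v - Real.log n) 0 * kernel x v) volume n x :=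
    (hc.mono (uIcc_subset_uIcc_right (by rw [uIcc_of_le hx2]; exact ⟨hn2, hnx⟩))).intervalIntegrable
  rw [← intervalIntegral.integral_add_adjacent_intervals hi1 hi2]
  have h1 : ∫ v in (2 : ℝ)..n, max (Real.log v - Real.log n) 0 * kernel x v = 0 := by
    have hEq : EqOn (fun v ↦ max (Real.log v - Real.log n) 0 * kernel x v) (fun _ ↦ (0 : ℝ)) (uIcc 2 n) := by
      intro v hv
      rw [uIcc_of_le hn2] at hv
      have : Real.log v ≤ Real.log n := Real.log_le_log (by linarith [hv.1]) hv.2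
      show max (Real.log v - Real.log n) 0 * kernel x v = 0
      rw [max_eq_right (by linarith), zero_mul]
    rw [intervalIntegral.integral_congr hEq, intervalIntegral.integral_zero]
  have h2 : ∫ v in (n : ℝ)..x, max (Real.log v - Real.log n) 0 * kernel x v =
      ∫ v in (n : ℝ)..x, (Real.log v - Real.log n) * kernel x v := by
    refine intervalIntegral.integral_congr fun v hv ↦ ?_
    rw [uIcc_of_le hnx] at hv
    have : Real.log n ≤ Real.log v := Real.log_le_log (by linarith) hv.1
    show max (Real.log v - Real.log n) 0 * kernel x v = (Real.log v - Real.log n) * kernel x v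
    rw [max_eq_left (by linarith)]
  rw [h1, h2, zero_add, integral_perW hn1 hnx]

/-- **The exact Cesàro identity**: for `x ≥ 2` and `a(1) = 0`,
`(1/x) Σ_{n ≤ x} (a(n)/log n)(x − n) = f_a(x)/log x + ∫₂^x f_a(v) φ_x(v) dv` — the tree's smoothed replacement for the
summation by parts `π_{1/2} = π/√x + ½∫π u^{-3/2}` of the printed proof. [cite: Hayani2025, Thm 1.4 (proof, §3)] -/
theorem cesaroNum_div_eq (a : ℕ → ℂ) (ha1 : a 1 = 0) {x : ℝ} (hx : 2 ≤ x) :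
    cesaroNum a x / x = rieszSum a x / (Real.log x : ℂ) +
      ∫ v in (2 : ℝ)..x, rieszSum a v * (kernel x v : ℂ) := by
  set N := ⌊x⌋₊ with hN
  have hx0 : 0 < x := by linarith
  have hx1 : 1 < x := by linarith
  have hxL : 0 < Real.log x := Real.log_pos hx1
  have hsI : ∀ v ∈ Icc 2 x, 1 < v := fun v hv ↦ by linarith [hv.1]
  -- (i) replace `f_a` by the fixed finite sum on `[2, x]`, (ii) swap sum and integral
  have hstep1 : ∫ v in (2 : ℝ)..x, rieszSum a v * (kernel x v : ℂ) =
      ∑ n ∈ Finset.Icc 1 N, a n * ∫ v in (2 : ℝ)..x,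
        (((max (Real.log v - Real.log n) 0) * kernel x v : ℝ) : ℂ) := by
    have hcongr : EqOn (fun v ↦ rieszSum a v * (kernel x v : ℂ))
        (fun v ↦ ∑ n ∈ Finset.Icc 1 N, a n * (((max (Real.log v - Real.log n) 0) * kernel x v : ℝ) : ℂ))
        (uIcc 2 x) := by
      intro v hv
      rw [uIcc_of_le hx] at hv
      simp only
      rw [rieszSum_eq_sum_posPart a (by linarith [hv.1]) hv.2, Finset.sum_mul]
      refine Finset.sum_congr rfl fun n _ ↦ ?_
      push_cast
      ring
    rw [intervalIntegral.integral_congr hcongr, intervalIntegral.integral_finsetSum]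
    · refine Finset.sum_congr rfl fun n _ ↦ ?_
      rw [intervalIntegral.integral_const_mul]
    · intro n _
      refine (continuousOn_const.mul ?_).intervalIntegrable
      rw [uIcc_of_le hx]
      exact Complex.continuous_ofReal.comp_continuousOn ((continuousOn_posPart_log n hsI).mul
        (continuousOn_kernel x hsI))
  rw [hstep1]
  -- (iii) evaluate each integral, (iv) sum up
  have hterm : ∀ n ∈ Finset.Icc 1 N, a n * ∫ v in (2 : ℝ)..x,
      (((max (Real.log v - Real.log n) 0) * kernel x v : ℝ) : ℂ) =
      a n / (Real.log n : ℂ) * ((x - n : ℝ) : ℂ) / x - a n * (Real.log (x / n) : ℂ) / (Real.log x : ℂ) := by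
    intro n hn
    rw [Finset.mem_Icc] at hn
    rcases eq_or_lt_of_le hn.1 with h1 | h1
    · rw [← h1, ha1]; simp
    · have hn2 : 2 ≤ n := h1
      have hnx : (n : ℝ) ≤ x := le_trans (by exact_mod_cast hn.2) (Nat.floor_le hx0.le)
      have hn0 : (0 : ℝ) < n := by exact_mod_cast (by omega : 0 < n)
      have hnL : 0 < Real.log n := Real.log_pos (by exact_mod_cast (by omega : 1 < n))
      rw [intervalIntegral.integral_ofReal, integral_posPart_kernel hn2 hnx, Real.log_div hx0.ne' hn0.ne']
      push_cast
      field_simp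
  rw [Finset.sum_congr rfl hterm, Finset.sum_sub_distrib]
  simp only [cesaroNum, rieszSum, Finset.sum_div, hN]
  ring

/-! ## §5 The Cesàro mean of `a(n)/log n` from a bounded-error expansion of `f_a` -/

/-- `φ₁` is measurable. [folklore] -/
private theorem measurable_phi1 : Measurable phi1 := by
  have h : phi1 = fun v ↦ 2 / (v * Real.log v ^ 3) := rfl
  rw [h]
  exact measurable_const.div (measurable_id.mul (Real.measurable_log.pow_const 3))

/-- `Φ₂` is measurable. [folklore] -/
private theorem measurable_Phi2 : Measurable Phi2 := by
  have h : Phi2 = fun v ↦ 1 / Real.log v - 2 / Real.log v ^ 2 + 2 / Real.log v ^ 3 := rfl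
  rw [h]
  exact ((measurable_const.div Real.measurable_log).sub
    (measurable_const.div (Real.measurable_log.pow_const 2))).add
    (measurable_const.div (Real.measurable_log.pow_const 3))

/-- `g₂` is measurable. [folklore] -/
private theorem measurable_gtwo : Measurable gtwo := by
  have h : gtwo = fun v ↦ (Real.log v - Real.log 2) ^ 2 / 2 := rfl
  rw [h]
  exact ((Real.measurable_log.sub measurable_const).pow_const 2).div_const 2

/-- `φ₁ ≥ 0` on `(1, ∞)`. [folklore] -/
private theorem phi1_nonneg {v : ℝ} (hv : 1 < v) : 0 ≤ phi1 v := by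
  have : 0 < Real.log v := Real.log_pos hv
  have hv0 : 0 < v := by linarith
  simp only [phi1]
  positivity

/-- **The Cesàro mean of `a(n)/log n`.** If `a(1) = 0` and the Riesz sum satisfies
`‖f_a(v) + c₀ log v + (m/2) log² v‖ ≤ B` for `v > 1`, then for some constants `C`, `K`:
`‖(1/x) Σ_{n ≤ x} (a(n)/log n)(x − n) + m log log x − C‖ ≤ K/log x` for all `x ≥ 2` (the mean-value mechanism of
Hayani's Thm 1.4, with the bounded-error Riesz expansion in place of `|∫Δ| ≪ log Y`). [cite: Hayani2025, Thm 1.4 (proof, §3)] -/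
theorem cesaro_of_rieszBound (a : ℕ → ℂ) (ha1 : a 1 = 0) {m c₀ : ℂ} {B : ℝ}
    (hB : ∀ v : ℝ, 1 < v → ‖rieszSum a v + (Real.log v : ℂ) * c₀ + m * (((Real.log v) ^ 2 / 2 : ℝ) : ℂ)‖ ≤ B) :
    ∃ C : ℂ, ∃ K : ℝ, ∀ x : ℝ, 2 ≤ x →
      ‖cesaroNum a x / x + m * (Real.log (Real.log x) : ℂ) - C‖ ≤ K / Real.log x := by
  have hlog2 : (0.6931471803 : ℝ) < Real.log 2 := Real.log_two_gt_d9
  have h2L : 0 < Real.log 2 := by linarith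
  -- the error term in the basis `g₁ = log v − log 2`, `g₂ = (log v − log 2)²/2`
  set c₁ : ℂ := m * (Real.log 2 : ℂ) + c₀ with hc₁
  set e : ℝ → ℂ := fun v ↦ rieszSum a v + m * (gtwo v : ℂ) + c₁ * ((Real.log v - Real.log 2 : ℝ) : ℂ) with he
  set B' : ℝ := B + ‖m * (((Real.log 2) ^ 2 / 2 : ℝ) : ℂ) + c₀ * (Real.log 2 : ℂ)‖ with hB'
  have hB0 : 0 ≤ B := le_trans (norm_nonneg _) (hB 2 (by norm_num))
  have hB'0 : 0 ≤ B' := add_nonneg hB0 (norm_nonneg _)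
  have he_bound : ∀ v : ℝ, 1 < v → ‖e v‖ ≤ B' := by
    intro v hv
    have key : e v = (rieszSum a v + (Real.log v : ℂ) * c₀ + m * (((Real.log v) ^ 2 / 2 : ℝ) : ℂ)) -
        (m * (((Real.log 2) ^ 2 / 2 : ℝ) : ℂ) + c₀ * (Real.log 2 : ℂ)) := by
      simp only [he, hc₁, gtwo]; push_cast; ring
    rw [key]
    exact (norm_sub_le _ _).trans (add_le_add (hB v hv) le_rfl)
  have he_meas : Measurable e :=
    ((measurable_rieszSum a).add (measurable_const.mul (Complex.measurable_ofReal.comp measurable_gtwo))).add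
      (measurable_const.mul (Complex.measurable_ofReal.comp (Real.measurable_log.sub measurable_const)))
  -- the improper integral `C_e = ∫₂^∞ e φ₁`
  obtain ⟨hφint2, -⟩ := integral_Ioi_phi1 (x := 2) (by norm_num)
  have heφ_int : IntegrableOn (fun v ↦ e v * (phi1 v : ℂ)) (Ioi 2) := by
    refine Integrable.mono' (hφint2.const_mul B') ?_ ?_
    · exact (he_meas.mul (Complex.measurable_ofReal.comp measurable_phi1)).aestronglyMeasurable
    · refine (ae_restrict_mem measurableSet_Ioi).mono fun v hv ↦ ?_
      have hv1 : 1 < v := lt_trans (by norm_num) hv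
      rw [norm_mul, Complex.norm_real, Real.norm_of_nonneg (phi1_nonneg hv1)]
      exact mul_le_mul_of_nonneg_right (he_bound v hv1) (phi1_nonneg hv1)
  set Ce : ℂ := ∫ v in Ioi 2, e v * (phi1 v : ℂ) with hCe
  refine ⟨Ce + m * (Real.log (Real.log 2) : ℂ) - c₁ / (Real.log 2 : ℂ),
    B' + B' / Real.log 2 + 45 * B' + 5 * ‖m‖ + 2 * ‖c₁‖ / Real.log 2, fun x hx ↦ ?_⟩
  have hx0 : 0 < x := by linarith
  have hx1 : 1 < x := by linarith
  have hxL : 0 < Real.log x := Real.log_pos hx1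
  have hxL2 : Real.log 2 ≤ Real.log x := Real.log_le_log (by norm_num) hx
  have hsI : ∀ v ∈ Icc 2 x, 1 < v := fun v hv ↦ by linarith [hv.1]
  have hsU : ∀ v ∈ uIcc 2 x, 1 < v := fun v hv ↦ by rw [uIcc_of_le hx] at hv; exact hsI v hv
  -- names for the pieces
  set Lx : ℂ := (Real.log x : ℂ) with hLx
  have hLx0 : Lx ≠ 0 := by rw [hLx]; exact_mod_cast hxL.ne'
  have hxC0 : (x : ℂ) ≠ 0 := by exact_mod_cast hx0.ne'
  set Li : ℝ := ∫ v in (2 : ℝ)..x, 1 / Real.log v with hLi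
  have hLi0 : 0 ≤ Li := integral_inv_log_nonneg le_rfl hx
  have hLi5 : Li ≤ 5 * x / Real.log x := integral_inv_log_le hx
  set T : ℂ := ∫ v in Ioi x, e v * (phi1 v : ℂ) with hT
  set IPhi : ℂ := ∫ v in (2 : ℝ)..x, e v * (Phi2 v : ℂ) with hIPhi
  set Iphi : ℂ := ∫ v in (2 : ℝ)..x, e v * (phi1 v : ℂ) with hIphi
  -- (1) the exact identity `cesaroNum/x = f(x)/log x + ∫ f·φ_x`
  have hid := cesaroNum_div_eq a ha1 hx
  -- (2) split `∫ f·φ_x = ∫ e·φ_x − m ∫ g₂ φ_x − c₁ ∫ g₁ φ_x`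
  have hI2c : IntervalIntegrable (fun v ↦ ((gtwo v * kernel x v : ℝ) : ℂ)) volume 2 x := by
    refine (Complex.continuous_ofReal.comp_continuousOn ?_).intervalIntegrable
    exact (continuousOn_gtwo hsU).mul (continuousOn_kernel x hsU)
  have hI1c : IntervalIntegrable (fun v ↦ (((Real.log v - Real.log 2) * kernel x v : ℝ) : ℂ)) volume 2 x := by
    refine (Complex.continuous_ofReal.comp_continuousOn ?_).intervalIntegrable
    exact ((continuousOn_log_of_one_lt hsU).sub continuousOn_const).mul (continuousOn_kernel x hsU)
  have hRK : IntervalIntegrable (fun v ↦ rieszSum a v * (kernel x v : ℂ)) volume 2 x :=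
    intervalIntegrable_rieszSum_mul a le_rfl hx (continuousOn_kernel x hsI)
  have hek : ∀ k : ℝ → ℝ, ContinuousOn k (Icc 2 x) →
      IntervalIntegrable (fun v ↦ e v * (k v : ℂ)) volume 2 x := by
    intro k hk
    have hkU : ContinuousOn k (uIcc 2 x) := by rwa [uIcc_of_le hx]
    have hA : IntervalIntegrable (fun v ↦ ((gtwo v * k v : ℝ) : ℂ)) volume 2 x :=
      (Complex.continuous_ofReal.comp_continuousOn ((continuousOn_gtwo hsU).mul hkU)).intervalIntegrable
    have hB : IntervalIntegrable (fun v ↦ (((Real.log v - Real.log 2) * k v : ℝ) : ℂ)) volume 2 x :=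
      (Complex.continuous_ofReal.comp_continuousOn
        (((continuousOn_log_of_one_lt hsU).sub continuousOn_const).mul hkU)).intervalIntegrable
    have h := (intervalIntegrable_rieszSum_mul a le_rfl hx hk).add ((hA.const_mul m).add (hB.const_mul c₁))
    refine h.congr_ae (Filter.Eventually.of_forall fun v ↦ ?_)
    simp only [he]
    push_cast
    ring
  have heK : IntervalIntegrable (fun v ↦ e v * (kernel x v : ℂ)) volume 2 x := hek _ (continuousOn_kernel x hsI)
  have hsplit : ∫ v in (2 : ℝ)..x, rieszSum a v * (kernel x v : ℂ) =
      (∫ v in (2 : ℝ)..x, e v * (kernel x v : ℂ)) - m * (∫ v in (2 : ℝ)..x, ((gtwo v * kernel x v : ℝ) : ℂ)) -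
        c₁ * (∫ v in (2 : ℝ)..x, (((Real.log v - Real.log 2) * kernel x v : ℝ) : ℂ)) := by
    have hc : ∫ v in (2 : ℝ)..x, rieszSum a v * (kernel x v : ℂ) =
        ∫ v in (2 : ℝ)..x, (e v * (kernel x v : ℂ) - m * ((gtwo v * kernel x v : ℝ) : ℂ) -
          c₁ * (((Real.log v - Real.log 2) * kernel x v : ℝ) : ℂ)) := by
      refine intervalIntegral.integral_congr fun v _ ↦ ?_
      simp only [he]
      push_cast
      ring
    rw [hc, intervalIntegral.integral_sub (heK.sub (hI2c.const_mul m)) (hI1c.const_mul c₁),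
      intervalIntegral.integral_sub heK (hI2c.const_mul m), intervalIntegral.integral_const_mul,
      intervalIntegral.integral_const_mul]
  -- (3) `∫ e·φ_x = ∫ e φ₁ − (1/x) ∫ e Φ₂`
  have heφ : IntervalIntegrable (fun v ↦ e v * (phi1 v : ℂ)) volume 2 x := hek _ (continuousOn_phi1 hsI)
  have heΦ : IntervalIntegrable (fun v ↦ e v * (Phi2 v : ℂ)) volume 2 x := hek _ (continuousOn_Phi2 hsI)
  have hIe : ∫ v in (2 : ℝ)..x, e v * (kernel x v : ℂ) = Iphi - (1 / x : ℂ) * IPhi := by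
    rw [hIphi, hIPhi, ← intervalIntegral.integral_const_mul, ← intervalIntegral.integral_sub heφ (heΦ.const_mul _)]
    refine intervalIntegral.integral_congr fun v _ ↦ ?_
    simp only [kernel]
    push_cast
    ring
  -- (4) `∫₂^x e φ₁ = C_e − T`
  have hIphi_eq : Iphi = Ce - T := by
    rw [hIphi, hCe, hT]
    exact (intervalIntegral.integral_Ioi_sub_Ioi heφ_int hx).symm
  -- (5) the two main-term identities, cast to `ℂ`
  have hg2 : (gtwo x : ℂ) / Lx + ∫ v in (2 : ℝ)..x, ((gtwo v * kernel x v : ℝ) : ℂ) =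
      (Real.log (Real.log x) : ℂ) - (Real.log (Real.log 2) : ℂ) - (1 / x : ℂ) * (Li : ℂ) := by
    rw [intervalIntegral.integral_ofReal, hLx, hLi]
    have h := gtwo_identity hx
    have h' := congrArg (fun r : ℝ ↦ (r : ℂ)) h
    push_cast at h' ⊢
    exact h'
  have hg1 : ((Real.log x - Real.log 2 : ℝ) : ℂ) / Lx +
      ∫ v in (2 : ℝ)..x, (((Real.log v - Real.log 2) * kernel x v : ℝ) : ℂ) =
      1 / (Real.log 2 : ℂ) - 2 / ((x : ℂ) * (Real.log 2 : ℂ)) := by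
    rw [intervalIntegral.integral_ofReal, hLx, integral_perW (w := 2) (by norm_num) hx]
    push_cast
    field_simp
    ring
  -- (6) `f(x) = e(x) − m g₂(x) − c₁ g₁(x)`
  have hR : rieszSum a x = e x - m * (gtwo x : ℂ) - c₁ * ((Real.log x - Real.log 2 : ℝ) : ℂ) := by
    simp only [he]; ring
  -- (7) assemble
  have hfinal : cesaroNum a x / x + m * (Real.log (Real.log x) : ℂ) -
      (Ce + m * (Real.log (Real.log 2) : ℂ) - c₁ / (Real.log 2 : ℂ)) =
      e x / Lx - T - (1 / x : ℂ) * IPhi + m * ((1 / x : ℂ) * (Li : ℂ)) + 2 * c₁ / ((x : ℂ) * (Real.log 2 : ℂ)) := by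
    rw [hid, hsplit, hIe, hIphi_eq, hR, ← hLx]
    linear_combination (-m) * hg2 - c₁ * hg1 -
      (∫ v in (2 : ℝ)..x, (((Real.log v - Real.log 2) * kernel x v : ℝ) : ℂ)) * hc₁
  rw [hfinal]
  -- (8) bound the five terms
  have h1 : ‖e x / Lx‖ ≤ B' / Real.log x := by
    rw [norm_div, hLx, Complex.norm_real, Real.norm_of_nonneg hxL.le]
    exact div_le_div_of_nonneg_right (he_bound x hx1) hxL.le
  have h2 : ‖T‖ ≤ B' / Real.log 2 / Real.log x := by
    obtain ⟨hφintx, hφval⟩ := integral_Ioi_phi1 hx1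
    have hb : ‖T‖ ≤ ∫ v in Ioi x, B' * phi1 v := by
      rw [hT]
      refine norm_integral_le_of_norm_le (hφintx.const_mul B') ?_
      refine (ae_restrict_mem measurableSet_Ioi).mono fun v hv ↦ ?_
      have hv1 : 1 < v := lt_trans hx1 hv
      rw [norm_mul, Complex.norm_real, Real.norm_of_nonneg (phi1_nonneg hv1)]
      exact mul_le_mul_of_nonneg_right (he_bound v hv1) (phi1_nonneg hv1)
    rw [MeasureTheory.integral_const_mul, hφval] at hb
    refine hb.trans ?_
    rw [div_div, le_div_iff₀ (by positivity)]
    calc B' * (1 / Real.log x ^ 2) * (Real.log 2 * Real.log x)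
        = B' * (Real.log 2 / Real.log x) := by field_simp
      _ ≤ B' * 1 := by
          refine mul_le_mul_of_nonneg_left ?_ hB'0
          rw [div_le_one hxL]; exact hxL2
      _ = B' := mul_one _
  have h3 : ‖(1 / x : ℂ) * IPhi‖ ≤ 45 * B' / Real.log x := by
    have hbd : ‖IPhi‖ ≤ ∫ v in (2 : ℝ)..x, 9 * B' * (1 / Real.log v) := by
      rw [hIPhi]
      refine intervalIntegral.norm_integral_le_of_norm_le hx ?_ ?_
      · refine Filter.Eventually.of_forall fun v hv ↦ ?_
        have hv1 : 1 < v := by linarith [hv.1]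
        have hvL : 0 < Real.log v := Real.log_pos hv1
        rw [norm_mul, Complex.norm_real, Real.norm_eq_abs]
        calc ‖e v‖ * |Phi2 v| ≤ B' * (9 / Real.log v) :=
              mul_le_mul (he_bound v hv1) (abs_Phi2_le hv.1.le) (abs_nonneg _) hB'0
          _ = 9 * B' * (1 / Real.log v) := by ring
      · exact ((continuousOn_const.div (continuousOn_log_of_one_lt hsU) fun v hv ↦
          (Real.log_pos (hsU v hv)).ne').const_mul _).intervalIntegrable
          |>.congr_ae (Filter.Eventually.of_forall fun v ↦ rfl)
    rw [intervalIntegral.integral_const_mul] at hbd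
    rw [norm_mul, norm_div, norm_one, Complex.norm_real, Real.norm_of_nonneg hx0.le]
    calc 1 / x * ‖IPhi‖ ≤ 1 / x * (9 * B' * Li) := mul_le_mul_of_nonneg_left hbd (by positivity)
      _ ≤ 1 / x * (9 * B' * (5 * x / Real.log x)) := by gcongr
      _ = 45 * B' / Real.log x := by field_simp; ring
  have h4 : ‖m * ((1 / x : ℂ) * (Li : ℂ))‖ ≤ 5 * ‖m‖ / Real.log x := by
    rw [norm_mul, norm_mul, norm_div, norm_one, Complex.norm_real, Complex.norm_real,
      Real.norm_of_nonneg hx0.le, Real.norm_of_nonneg hLi0]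
    calc ‖m‖ * (1 / x * Li) ≤ ‖m‖ * (1 / x * (5 * x / Real.log x)) := by gcongr
      _ = 5 * ‖m‖ / Real.log x := by field_simp
  have h5 : ‖2 * c₁ / ((x : ℂ) * (Real.log 2 : ℂ))‖ ≤ 2 * ‖c₁‖ / Real.log 2 / Real.log x := by
    rw [norm_div, norm_mul, norm_mul, Complex.norm_real, Complex.norm_real, Real.norm_of_nonneg hx0.le,
      Real.norm_of_nonneg h2L.le, Complex.norm_two, div_div]
    have hlx : Real.log x ≤ x := (Real.log_le_sub_one_of_pos hx0).trans (by linarith)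
    exact div_le_div_of_nonneg_left (by positivity) (by positivity) (by nlinarith)
  calc ‖e x / Lx - T - (1 / x : ℂ) * IPhi + m * ((1 / x : ℂ) * (Li : ℂ)) + 2 * c₁ / ((x : ℂ) * (Real.log 2 : ℂ))‖
      ≤ ‖e x / Lx - T - (1 / x : ℂ) * IPhi + m * ((1 / x : ℂ) * (Li : ℂ))‖ +
          ‖2 * c₁ / ((x : ℂ) * (Real.log 2 : ℂ))‖ := norm_add_le _ _
    _ ≤ ‖e x / Lx - T - (1 / x : ℂ) * IPhi‖ + ‖m * ((1 / x : ℂ) * (Li : ℂ))‖ +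
          ‖2 * c₁ / ((x : ℂ) * (Real.log 2 : ℂ))‖ := by gcongr; exact norm_add_le _ _
    _ ≤ ‖e x / Lx - T‖ + ‖(1 / x : ℂ) * IPhi‖ + ‖m * ((1 / x : ℂ) * (Li : ℂ))‖ +
          ‖2 * c₁ / ((x : ℂ) * (Real.log 2 : ℂ))‖ := by gcongr; exact norm_sub_le _ _
    _ ≤ ‖e x / Lx‖ + ‖T‖ + ‖(1 / x : ℂ) * IPhi‖ + ‖m * ((1 / x : ℂ) * (Li : ℂ))‖ +
          ‖2 * c₁ / ((x : ℂ) * (Real.log 2 : ℂ))‖ := by gcongr; exact norm_sub_le _ _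
    _ ≤ B' / Real.log x + B' / Real.log 2 / Real.log x + 45 * B' / Real.log x + 5 * ‖m‖ / Real.log x +
          2 * ‖c₁‖ / Real.log 2 / Real.log x := by gcongr
    _ = (B' + B' / Real.log 2 + 45 * B' + 5 * ‖m‖ + 2 * ‖c₁‖ / Real.log 2) / Real.log x := by
        field_simp

/-! ## §6 Cesàro means of step functions with a pointwise `log log` asymptotic -/

/-- `∫_{a}^{b} log log u du = b log log b − a log log a − ∫_a^b du/log u` for `2 ≤ a ≤ b`. [folklore] -/
private theorem integral_loglog {a b : ℝ} (ha : 2 ≤ a) (hab : a ≤ b) :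
    ∫ u in a..b, Real.log (Real.log u) =
      b * Real.log (Real.log b) - a * Real.log (Real.log a) - ∫ u in a..b, 1 / Real.log u := by
  have hs : ∀ u ∈ uIcc a b, 1 < u := fun u hu ↦ by rw [uIcc_of_le hab] at hu; linarith [hu.1]
  have hderiv : ∀ u ∈ uIcc a b, HasDerivAt (fun t ↦ Real.log (Real.log t)) ((Real.log u)⁻¹ * u⁻¹) u := by
    intro u hu
    have hu1 := hs u hu
    have hu0 : (0 : ℝ) < u := by linarith
    exact (Real.hasDerivAt_log (Real.log_pos hu1).ne').comp u (Real.hasDerivAt_log hu0.ne')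
  have hid : ∀ u ∈ uIcc a b, HasDerivAt (fun t : ℝ ↦ t) (1 : ℝ) u := fun u _ ↦ hasDerivAt_id u
  have hc1 : ContinuousOn (fun u ↦ (Real.log u)⁻¹ * u⁻¹) (uIcc a b) := by
    refine ((continuousOn_log_of_one_lt hs).inv₀ fun u hu ↦ (Real.log_pos (hs u hu)).ne').mul
      (continuousOn_inv₀.mono ?_)
    intro u hu; exact ne_of_gt (by linarith [hs u hu])
  have h := intervalIntegral.integral_mul_deriv_eq_deriv_mul hderiv hid hc1.intervalIntegrable
    intervalIntegrable_const
  simp only [mul_one] at h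
  have h2 : ∫ u in a..b, (Real.log u)⁻¹ * u⁻¹ * u = ∫ u in a..b, 1 / Real.log u := by
    refine intervalIntegral.integral_congr fun u hu ↦ ?_
    have hu0 : (u : ℝ) ≠ 0 := ne_of_gt (by linarith [hs u hu])
    show (Real.log u)⁻¹ * u⁻¹ * u = 1 / Real.log u
    field_simp
  rw [h, h2]
  ring

/-- **Cesàro means from a pointwise asymptotic.** If `‖S_c(u) − α log log u − β‖ ≤ K/log u` for
`u ≥ u₀ ≥ 2`, then for some `K'` and all `x ≥ u₀`:
`‖(1/x) Σ_{n ≤ x} c(n)(x − n) − α log log x − β‖ ≤ K'/log x` («using the classical estimate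
`∫ e^y log y dy = e^Y log Y + O(e^Y/Y)`»). [cite: Hayani2025, Thm 1.4 (proof, §3)] -/
theorem cesaro_of_pointwise (c : ℕ → ℂ) {α β : ℂ} {K u₀ : ℝ} (hu₀ : 2 ≤ u₀)
    (h : ∀ u : ℝ, u₀ ≤ u → ‖stepSum c u - α * (Real.log (Real.log u) : ℂ) - β‖ ≤ K / Real.log u) :
    ∃ K' : ℝ, ∀ x : ℝ, u₀ ≤ x →
      ‖(∑ n ∈ Finset.Icc 1 ⌊x⌋₊, c n * ((x - n : ℝ) : ℂ)) / x - α * (Real.log (Real.log x) : ℂ) - β‖ ≤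
        K' / Real.log x := by
  set D₀ : ℂ := ∫ u in (1 : ℝ)..u₀, stepSum c u with hD₀
  set D : ℝ := ‖D₀ - α * ((u₀ * Real.log (Real.log u₀) : ℝ) : ℂ) - β * (u₀ : ℂ)‖ with hD
  refine ⟨D + 5 * |K| + 5 * ‖α‖, fun x hx ↦ ?_⟩
  have hx2 : 2 ≤ x := hu₀.trans hx
  have hx0 : 0 < x := by linarith
  have hx1 : 1 < x := by linarith
  have hxL : 0 < Real.log x := Real.log_pos hx1
  have hxC0 : (x : ℂ) ≠ 0 := by exact_mod_cast hx0.ne'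
  have hsU : ∀ u ∈ uIcc u₀ x, 1 < u := fun u hu ↦ by rw [uIcc_of_le hx] at hu; linarith [hu.1]
  -- the pieces
  set err : ℝ → ℂ := fun u ↦ stepSum c u - α * (Real.log (Real.log u) : ℂ) - β with herr
  set E : ℂ := ∫ u in u₀..x, err u with hE
  set Li : ℝ := ∫ u in u₀..x, 1 / Real.log u with hLi
  have hLi0 : 0 ≤ Li := integral_inv_log_nonneg hu₀ hx
  have hLi5 : Li ≤ 5 * x / Real.log x := integral_inv_log_le' hu₀ hx
  -- (1) `Σ c(n)(x − n) = ∫₁^x S = D₀ + ∫_{u₀}^x S`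
  have hsum : ∑ n ∈ Finset.Icc 1 ⌊x⌋₊, c n * ((x - n : ℝ) : ℂ) = D₀ + ∫ u in u₀..x, stepSum c u := by
    rw [← integral_stepSum c hx1.le, hD₀]
    exact (intervalIntegral.integral_add_adjacent_intervals (intervalIntegrable_stepSum c _ _)
      (intervalIntegrable_stepSum c _ _)).symm
  -- (2) `∫_{u₀}^x S = E + α ∫ log log + β (x − u₀)`
  have hll_cont : ContinuousOn (fun u ↦ (Real.log (Real.log u) : ℂ)) (uIcc u₀ x) :=
    Complex.continuous_ofReal.comp_continuousOn ((continuousOn_log_of_one_lt hsU).log fun u hu ↦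
      (Real.log_pos (hsU u hu)).ne')
  have hmain_int : IntervalIntegrable (fun u ↦ α * (Real.log (Real.log u) : ℂ) + β) volume u₀ x :=
    ((hll_cont.intervalIntegrable).const_mul α).add intervalIntegrable_const
  have herr_int : IntervalIntegrable err volume u₀ x := by
    have h := (intervalIntegrable_stepSum c u₀ x).sub hmain_int
    refine h.congr_ae (Filter.Eventually.of_forall fun u ↦ ?_)
    simp only [herr]
    ring
  have hS : ∫ u in u₀..x, stepSum c u =
      E + α * ((∫ u in u₀..x, Real.log (Real.log u) : ℝ) : ℂ) + β * ((x - u₀ : ℝ) : ℂ) := by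
    have h1 : ∫ u in u₀..x, stepSum c u = ∫ u in u₀..x, (err u + (α * (Real.log (Real.log u) : ℂ) + β)) := by
      refine intervalIntegral.integral_congr fun u _ ↦ ?_
      simp only [herr]; ring
    rw [h1, intervalIntegral.integral_add herr_int hmain_int, intervalIntegral.integral_add
      (hll_cont.intervalIntegrable.const_mul α) intervalIntegrable_const, intervalIntegral.integral_const_mul,
      intervalIntegral.integral_ofReal, intervalIntegral.integral_const, hE]
    simp only [Complex.real_smul]
    push_cast
    ring
  -- (3) by parts
  have hparts := integral_loglog hu₀ hx
  -- (4) the identity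
  have hid : (∑ n ∈ Finset.Icc 1 ⌊x⌋₊, c n * ((x - n : ℝ) : ℂ)) / x - α * (Real.log (Real.log x) : ℂ) - β =
      (D₀ - α * ((u₀ * Real.log (Real.log u₀) : ℝ) : ℂ) - β * (u₀ : ℂ)) / x + E / x -
        α * (Li : ℂ) / x := by
    rw [hsum, hS, hparts, hLi]
    push_cast
    field_simp
    ring
  rw [hid]
  -- (5) bounds
  have hE : ‖E‖ ≤ |K| * Li := by
    have hb : ‖E‖ ≤ ∫ u in u₀..x, |K| * (1 / Real.log u) := by
      refine intervalIntegral.norm_integral_le_of_norm_le hx ?_ ?_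
      · refine Filter.Eventually.of_forall fun u hu ↦ ?_
        have hu1 : 1 < u := by linarith [hu.1]
        have huL : 0 < Real.log u := Real.log_pos hu1
        calc ‖err u‖ ≤ K / Real.log u := h u hu.1.le
          _ ≤ |K| / Real.log u := div_le_div_of_nonneg_right (le_abs_self K) huL.le
          _ = |K| * (1 / Real.log u) := by ring
      · exact ((continuousOn_const.div (continuousOn_log_of_one_lt hsU) fun u hu ↦
          (Real.log_pos (hsU u hu)).ne').const_mul _).intervalIntegrable
          |>.congr_ae (Filter.Eventually.of_forall fun u ↦ rfl)
    rwa [intervalIntegral.integral_const_mul] at hb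
  have hinv : 1 / x ≤ 1 / Real.log x := inv_le_inv_log hx1
  have h1 : ‖(D₀ - α * ((u₀ * Real.log (Real.log u₀) : ℝ) : ℂ) - β * (u₀ : ℂ)) / x‖ ≤ D / Real.log x := by
    rw [norm_div, Complex.norm_real, Real.norm_of_nonneg hx0.le, ← hD, div_eq_mul_one_div, div_eq_mul_one_div D]
    exact mul_le_mul_of_nonneg_left hinv (norm_nonneg _)
  have h2 : ‖E / x‖ ≤ 5 * |K| / Real.log x := by
    rw [norm_div, Complex.norm_real, Real.norm_of_nonneg hx0.le, div_le_iff₀ hx0]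
    calc ‖E‖ ≤ |K| * Li := hE
      _ ≤ |K| * (5 * x / Real.log x) := mul_le_mul_of_nonneg_left hLi5 (abs_nonneg K)
      _ = 5 * |K| / Real.log x * x := by field_simp
  have h3 : ‖α * (Li : ℂ) / x‖ ≤ 5 * ‖α‖ / Real.log x := by
    rw [norm_div, norm_mul, Complex.norm_real, Complex.norm_real, Real.norm_of_nonneg hx0.le,
      Real.norm_of_nonneg hLi0, div_le_iff₀ hx0]
    calc ‖α‖ * Li ≤ ‖α‖ * (5 * x / Real.log x) := mul_le_mul_of_nonneg_left hLi5 (norm_nonneg α)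
      _ = 5 * ‖α‖ / Real.log x * x := by field_simp
  calc ‖(D₀ - α * ((u₀ * Real.log (Real.log u₀) : ℝ) : ℂ) - β * (u₀ : ℂ)) / x + E / x - α * (Li : ℂ) / x‖
      ≤ ‖(D₀ - α * ((u₀ * Real.log (Real.log u₀) : ℝ) : ℂ) - β * (u₀ : ℂ)) / x + E / x‖ + ‖α * (Li : ℂ) / x‖ :=
        norm_sub_le _ _
    _ ≤ ‖(D₀ - α * ((u₀ * Real.log (Real.log u₀) : ℝ) : ℂ) - β * (u₀ : ℂ)) / x‖ + ‖E / x‖ + ‖α * (Li : ℂ) / x‖ := by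
        gcongr; exact norm_add_le _ _
    _ ≤ D / Real.log x + 5 * |K| / Real.log x + 5 * ‖α‖ / Real.log x := by gcongr
    _ = (D + 5 * |K| + 5 * ‖α‖) / Real.log x := by ring

end Hayani2025Mean

end Literature.NumberTheory.LFunctions

end
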